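import Summits.SmoothPoincare4.SmoothPoincare4.Theses.WeakReductionDescent
import Literature.Topology.FourManifolds.SphereTrisectionsSectors
import Literature.Topology.FourManifolds.TrisectionFunctorGKNaturality
import Literature.Topology.FourManifolds.WeaklyReducibleTrisections

/-!
# `WeakReductionReduces` — negative-side support: refutation cost and the strongest variant
# (crux stmt-SmoothPoincare4-17908, cdisprove seat)

Crux K2 `WeakReductionDescent.WeakReductionReduces`: for every smooth homotopy 4-sphere `M` (the
Statement's bare binders + `e : M ≃ₕ S⁴`) and every WEAKLY REDUCIBLE Gay–Kirby trisection `T` of genus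
`g ≥ 4` that is of MINIMAL genus for `M`, `T` is reducible.

* `not_smoothPoincare4_of_not_weakReductionReduces` — REFUTATION COST: `¬ K2 → ¬ SmoothPoincare4`.
  The round `S⁴` carries Gay–Kirby's genus-`0` trisection
  (`Literature.Topology.FourManifolds.sphere_genusZero_gkTrisection_holds`, proved) and trisections
  transport along diffeomorphisms (`IsGKTrisection.image_diffeomorph'`, proved), so under the summit
  no trisection of genus `≥ 1` of a homotopy sphere is minimal and K2 holds by vacuity (first observed
  in the birth attack, `Cruxes/WeakReductionReduces/BirthAttack.lean`).  No finite, degenerate or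
  junk model can kill the crux; `exotic_of_not_weakReductionReduces` spells out the counterexample
  sector (an exotic `S⁴` carrying a minimal, weakly reducible, irreducible GK-trisection of genus
  `≥ 4`).
* `not_noMinimalFromFour_of_not_weakReductionReduces` / `noMinimalFromFour_iff_smoothPoincare4` —
  THE STRONGEST VARIANT IS THE SUMMIT.  Deleting the weak-reducibility hypothesis AND replacing the
  conclusion by `False` gives "no smooth homotopy 4-sphere has a minimal GK-trisection of genus `≥ 4`"
  (stated inline), which still implies K2 and is EQUIVALENT to `SmoothPoincare4` modulo the route's
  support `LowGenusBase` (MSZ16 / MZ17), the genus-3 frontier `hThree` ("genus-3 homotopy spheres are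
  standard": the open `(3;1,1,1)` case, in this route `DependentTripleAtThree` +
  `DependentTripleGenusThreeStandard`) and the proved item `TrisectionsExist` (take a trisection of
  least genus, `Nat.find`).  So every mutation of K2 that keeps (`e`, `4 ≤ g`, minimal) — weak
  reducibility weakened or dropped, "reducible" strengthened up to `False` — is refutable only by an
  exotic 4-sphere: the Casson–Gordon language is load-bearing for the proof METHOD, never for the
  truth value modulo the summit.
* `withoutMinimal_specialises_to_sphere` — the genuinely load-bearing hypotheses are MINIMALITY and
  `e`: with minimality dropped the statement asserts of the ROUND sphere that every weakly reducible
  GK-trisection of genus `≥ 4` is reducible (MSZ16 Conj. 3.11 / Aranda–Zupan 2025 §8 territory: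
  five-chain creations on knots generating `π₁(S¹ × S³)` are "strong candidates for being
  non-standard", arXiv:2503.04607 p. 27 — expected false, uncertified); with `e` dropped it is false
  in print one rung below (`S₂`, the spin of `ℝP³`: weakly reducible, irreducible, minimal genus-3
  trisection, arXiv:2503.04607 Fig. 3 and Lemma 2.7).  Details and the genus-4 witness design
  (`S¹ × L(p,q)`, whose genus-4 trisections are all minimal and irreducible in print) are in the crux
  work file `Cruxes/WeakReductionReduces/Disproof.lean`.
-/

noncomputable section

-- the prescribed namespace `Summit.<P>.<Sub>.…` duplicates `SmoothPoincare4` (P = Sub)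
set_option linter.dupNamespace false

open scoped Manifold ContDiff Topology ContinuousMap
open Set
open Literature.Topology.FourManifolds
open Summit.SmoothPoincare4.SmoothPoincare4.Theses.WeakReductionDescent

namespace Summit.SmoothPoincare4.SmoothPoincare4.Theorems.WeakReductionReduces.Negative

/-- A diffeomorphism to the round sphere pulls Gay–Kirby's genus-`0` trisection of `S⁴` back, so no
GK-trisection of genus `≥ 1` of such an `M` is of minimal genus. [folklore] -/
theorem not_minimal_of_diffeomorph {M : Type} [TopologicalSpace M]
    [ChartedSpace (EuclideanSpace ℝ (Fin 4)) M] [IsManifold (𝓡 4) ∞ M]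
    (Φ : M ≃ₘ⟮𝓡 4, 𝓡 4⟯ (Metric.sphere (0 : EuclideanSpace ℝ (Fin 5)) 1)) {g : ℕ} (hg : 1 ≤ g)
    (hmin : ∀ (g' : ℕ) (k' : Fin 3 → ℕ) (T' : Fin 3 → Set M), IsGKTrisection M g' k' T' → g ≤ g') :
    False := by
  obtain ⟨S₀, hS₀⟩ := sphere_genusZero_gkTrisection_holds
  have h0 := hmin 0 (fun _ => 0) (fun i => Φ.symm '' S₀ i)
    (hS₀.isGKTrisection.image_diffeomorph' Φ.symm)
  omega

/-- Under the summit no GK-trisection of genus `≥ 1` of a smooth homotopy 4-sphere is of minimal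
genus. [folklore] -/
theorem not_minimal_of_smoothPoincare4 (h : _root_.SmoothPoincare4) {M : Type} [TopologicalSpace M]
    [T2Space M] [SecondCountableTopology M] [ChartedSpace (EuclideanSpace ℝ (Fin 4)) M]
    [IsManifold (𝓡 4) ∞ M] (e : M ≃ₕ (Metric.sphere (0 : EuclideanSpace ℝ (Fin 5)) 1)) {g : ℕ} (hg : 1 ≤ g)
    (hmin : ∀ (g' : ℕ) (k' : Fin 3 → ℕ) (T' : Fin 3 → Set M), IsGKTrisection M g' k' T' → g ≤ g') :
    False := by
  obtain ⟨Φ⟩ := h M ‹_› ‹_› e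
  exact not_minimal_of_diffeomorph Φ hg hmin

/-- **Refutation cost of the crux.** `¬ WeakReductionReduces → ¬ SmoothPoincare4`: the summit makes
every homotopy 4-sphere standard, hence without minimal trisections of genus `≥ 4`, so K2 holds
vacuously under it; killing K2 kills the summit. [folklore] -/
theorem not_smoothPoincare4_of_not_weakReductionReduces (h : ¬ WeakReductionReduces) :
    ¬ _root_.SmoothPoincare4 := by
  intro hs
  refine h ?_
  intro M _ _ _ _ _ e g k T _hT hg hmin _hwr
  exact (not_minimal_of_smoothPoincare4 hs e (by omega) hmin).elim

/-- **The counterexample sector.** A refutation of K2 is a smooth homotopy 4-sphere carrying a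
GK-trisection of genus `≥ 4` that is minimal, weakly reducible and NOT reducible; such an `M` admits
no diffeomorphism to the round `S⁴` — an exotic 4-sphere of trisection genus `≥ 4`. [folklore] -/
theorem exotic_of_not_weakReductionReduces (h : ¬ WeakReductionReduces) :
    ∃ (M : Type) (_ : TopologicalSpace M) (_ : T2Space M) (_ : SecondCountableTopology M)
      (_ : ChartedSpace (EuclideanSpace ℝ (Fin 4)) M) (_ : IsManifold (𝓡 4) ∞ M),
      Nonempty (M ≃ₕ (Metric.sphere (0 : EuclideanSpace ℝ (Fin 5)) 1)) ∧
      (∃ (g : ℕ) (k : Fin 3 → ℕ) (T : Fin 3 → Set M), IsGKTrisection M g k T ∧ 4 ≤ g ∧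
        (∀ (g' : ℕ) (k' : Fin 3 → ℕ) (T' : Fin 3 → Set M), IsGKTrisection M g' k' T' → g ≤ g') ∧
        Trisection.IsWeaklyReducible T ∧ ¬ Trisection.IsReducible T) ∧
      IsEmpty (M ≃ₘ⟮𝓡 4, 𝓡 4⟯ (Metric.sphere (0 : EuclideanSpace ℝ (Fin 5)) 1)) := by
  by_contra hcon
  refine h ?_
  intro M _ _ _ _ _ e g k T hT hg hmin hwr
  by_contra hred
  exact hcon ⟨M, ‹_›, ‹_›, ‹_›, ‹_›, ‹_›, ⟨e⟩, ⟨g, k, T, hT, hg, hmin,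
    (Trisection.isWeaklyReducible_iff T).2 hwr,
    fun h' => hred ((Trisection.isReducible_iff T).1 h')⟩,
    ⟨fun Φ => not_minimal_of_diffeomorph Φ (le_trans (by norm_num) hg) hmin⟩⟩

/-- **Sandwich.** `¬ K2` refutes the strongest variant "no smooth homotopy 4-sphere has a minimal
GK-trisection of genus `≥ 4`" (the variant implies K2 trivially, as it implies every statement with
the hypotheses `e`, `4 ≤ g`, minimal). [folklore] -/
theorem not_noMinimalFromFour_of_not_weakReductionReduces (h : ¬ WeakReductionReduces) :
    ¬ (∀ (M : Type) [TopologicalSpace M] [T2Space M] [SecondCountableTopology M]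
        [ChartedSpace (EuclideanSpace ℝ (Fin 4)) M] [IsManifold (𝓡 4) ∞ M],
        (M ≃ₕ (Metric.sphere (0 : EuclideanSpace ℝ (Fin 5)) 1)) → ∀ (g : ℕ) (k : Fin 3 → ℕ) (T : Fin 3 → Set M), IsGKTrisection M g k T → 4 ≤ g →
          ¬ ∀ (g' : ℕ) (k' : Fin 3 → ℕ) (T' : Fin 3 → Set M), IsGKTrisection M g' k' T' → g ≤ g') := by
  intro hNo
  refine h ?_
  intro M _ _ _ _ _ e g k T hT hg hmin _hwr
  exact (hNo M e g k T hT hg hmin).elim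

/-- **The strongest variant is the summit.** Modulo the route's support `LowGenusBase` (genus `≤ 2`
homotopy spheres are `S⁴`), the genus-3 frontier `hThree` (genus-3 homotopy spheres are `S⁴`) and the
proved item `TrisectionsExist`, "no smooth homotopy 4-sphere has a minimal GK-trisection of genus
`≥ 4`" is EQUIVALENT to `SmoothPoincare4` (`→`: a trisection of least genus, `Nat.find`, has genus
`≤ 3`; `←`: the genus-`0` trisection of `S⁴` pulled back). [folklore] -/
theorem noMinimalFromFour_iff_smoothPoincare4 (h5 : LowGenusBase)
    (hThree : ∀ (M : Type) [TopologicalSpace M] [T2Space M] [SecondCountableTopology M]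
      [ChartedSpace (EuclideanSpace ℝ (Fin 4)) M] [IsManifold (𝓡 4) ∞ M],
      (M ≃ₕ (Metric.sphere (0 : EuclideanSpace ℝ (Fin 5)) 1)) → ∀ (k : Fin 3 → ℕ) (T : Fin 3 → Set M), IsGKTrisection M 3 k T →
        Nonempty (M ≃ₘ⟮𝓡 4, 𝓡 4⟯ (Metric.sphere (0 : EuclideanSpace ℝ (Fin 5)) 1)))
    (h6 : TrisectionsExist) :
    (∀ (M : Type) [TopologicalSpace M] [T2Space M] [SecondCountableTopology M]
        [ChartedSpace (EuclideanSpace ℝ (Fin 4)) M] [IsManifold (𝓡 4) ∞ M],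
        (M ≃ₕ (Metric.sphere (0 : EuclideanSpace ℝ (Fin 5)) 1)) → ∀ (g : ℕ) (k : Fin 3 → ℕ) (T : Fin 3 → Set M), IsGKTrisection M g k T → 4 ≤ g →
          ¬ ∀ (g' : ℕ) (k' : Fin 3 → ℕ) (T' : Fin 3 → Set M), IsGKTrisection M g' k' T' → g ≤ g') ↔
      _root_.SmoothPoincare4 := by
  constructor
  · intro hNo
    unfold SmoothPoincare4 Literature.SPC4.SmoothPoincareConjectureFour
      ContinuousMap.HomotopyEquiv.NonemptyDiffeomorphSphere
    intro M _ _ _ _ _ e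
    classical
    have hex : ∃ g : ℕ, ∃ (k : Fin 3 → ℕ) (T : Fin 3 → Set M), IsGKTrisection M g k T := by
      obtain ⟨g, k, T, hT⟩ := h6 M e
      exact ⟨g, k, T, hT⟩
    obtain ⟨k₀, T₀, hT₀⟩ := Nat.find_spec hex
    have hmin : ∀ (g' : ℕ) (k' : Fin 3 → ℕ) (T' : Fin 3 → Set M), IsGKTrisection M g' k' T' →
        Nat.find hex ≤ g' :=
      fun g' k' T' hT' => Nat.find_min' hex ⟨k', T', hT'⟩
    rcases Nat.lt_or_ge (Nat.find hex) 3 with hlt | hge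
    · exact h5 M e _ k₀ T₀ hT₀ (by omega)
    rcases Nat.lt_or_ge (Nat.find hex) 4 with hlt4 | hge4
    · have h3 : Nat.find hex = 3 := by omega
      rw [h3] at hT₀
      exact hThree M e k₀ T₀ hT₀
    · exact (hNo M e _ k₀ T₀ hT₀ hge4 hmin).elim
  · intro hs M _ _ _ _ _ e g k T _hT hg hmin
    exact not_minimal_of_smoothPoincare4 hs e (by omega) hmin

/-- **Why minimality is load-bearing (the unshielded shadow).** K2 with minimality dropped asserts of
the ROUND sphere that every weakly reducible GK-trisection of genus `≥ 4` is reducible — not a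
consequence of the summit (MSZ16 Conj. 3.11 / Aranda–Zupan 2025 Prop. 8.1, Q. 8.2: five-chain
creations are expected irreducible). [folklore] -/
theorem withoutMinimal_specialises_to_sphere
    (hW : ∀ (M : Type) [TopologicalSpace M] [T2Space M] [SecondCountableTopology M]
      [ChartedSpace (EuclideanSpace ℝ (Fin 4)) M] [IsManifold (𝓡 4) ∞ M],
      (M ≃ₕ (Metric.sphere (0 : EuclideanSpace ℝ (Fin 5)) 1)) → ∀ (g : ℕ) (k : Fin 3 → ℕ) (T : Fin 3 → Set M), IsGKTrisection M g k T → 4 ≤ g →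
        Trisection.IsWeaklyReducible T → Trisection.IsReducible T)
    (g : ℕ) (k : Fin 3 → ℕ) (T : Fin 3 → Set (Metric.sphere (0 : EuclideanSpace ℝ (Fin 5)) 1)) (hT : IsGKTrisection (Metric.sphere (0 : EuclideanSpace ℝ (Fin 5)) 1) g k T) (hg : 4 ≤ g)
    (hwr : Trisection.IsWeaklyReducible T) : Trisection.IsReducible T :=
  hW (Metric.sphere (0 : EuclideanSpace ℝ (Fin 5)) 1) (ContinuousMap.HomotopyEquiv.refl (Metric.sphere (0 : EuclideanSpace ℝ (Fin 5)) 1)) g k T hT hg hwr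

end Summit.SmoothPoincare4.SmoothPoincare4.Theorems.WeakReductionReduces.Negative

end
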